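import Mathlib.RingTheory.PowerSeries.Derivative
import Mathlib.RingTheory.PowerSeries.Order
import Mathlib.RingTheory.Derivation.Basic
import Mathlib.Algebra.Polynomial.Taylor
import Mathlib.Algebra.Polynomial.Derivative
import Mathlib.Algebra.Polynomial.BigOperators
import Mathlib.LinearAlgebra.Matrix.Determinant.Basic
import HarnessLib

/-!
# Barrier (Schanuel) `EFunctionValuesAtAlgebraicPoints`: linear forms in solutions of a differential system (Baker Ch. 11 §2) — proofs only

`Literature/Barriers/Schanuel/EFunctionValuesAtAlgebraicPointsForms.lean` — sibling file of
`EFunctionValuesAtAlgebraicPoints.lean` in the programme to discharge `siegelShidlovskii_algIndep`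
(Siegel–Shidlovskii; Rivoal Thm. 5.10 = Baker Thm. 11.1). This file is the purely algebraic
bookkeeping of Baker, *Transcendental Number Theory* (1975), Ch. 11 §2, for a linear differential
system written with a common denominator,
`f(x) yᵢ′ = ∑ⱼ Gᵢⱼ(x) yⱼ` (`f ∈ K[X]`, `G ∈ Mₙ(K[X])`; Baker's `yᵢ′ = ∑ fᵢⱼ yⱼ` with `f fᵢⱼ = Gᵢⱼ`):

* `SiegelShidlovskii.form ι y q = ∑ᵢ ι(qᵢ) yᵢ` — a linear form with polynomial coefficients
  `q ∈ K[X]ⁿ` evaluated at a vector `y` with entries in a `K`-algebra `R` into which `K[X]` maps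
  by `ι` (instances used later: `R = K⟦X⟧` with `ι` the coercion, and `R = K⟦X⟧` with `ι` the
  Taylor shift at a regular point);
* `SiegelShidlovskii.dualD f G q`, Baker's recursion `P_{i,j+1} = f P′_{ij} + ∑ₕ (f fₕᵢ) Pₕⱼ`
  (p. 110), and the identity behind it: for a solution `y` (`SiegelShidlovskii.IsSol`) and a
  derivation `d` compatible with `ι`, `ι(f) · d(form y q) = form y (dualD q)`
  (`form_dualD`, iterated in `form_dualD_iterate`) — "`Lⱼ` satisfies `L_{j+1} = f Lⱼ′`" (p. 110);
* degree growth `deg (dualD^[j] q)ᵢ ≤ N + j·m` with `m = sysDeg f G` (`natDegree_dualD_iterate_le`),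
  Baker's "`P_{ij}` has degree at most `r + mj`" (p. 112);
* for `R = K⟦X⟧`: vanishing orders drop by at most one per step
  (`le_order_form_dualD_iterate`), Baker's "each element of `L` has a zero at `x = 0` with
  order at least `M − n`" (p. 110).

Everything here is elementary commutative algebra ([folklore]) arranged for Lemma 2–4 of
Baker Ch. 11; no named facts, no analysis.

## References

* A. Baker, *Transcendental Number Theory*, CUP 1975, Ch. 11 §2 (pp. 109–111).
* [Rivoal2024] T. Rivoal, *Les E-fonctions et G-fonctions de Siegel* (2024), §5.3 (the
  functions `R_k = T R′_{k-1}`, p. 238).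
-/

noncomputable section

open Polynomial

namespace Literature.Barriers.Schanuel

namespace SiegelShidlovskii

variable {K : Type*} [Field K]
variable {R : Type*} [CommRing R] [Algebra K R]
variable {n : ℕ}

/-! ### 1. Linear forms with polynomial coefficients -/

/-- The linear form `∑ᵢ ι(qᵢ) · yᵢ` with polynomial coefficient vector `q`, evaluated at the
vector `y` of elements of a `K`-algebra `R` (Baker's `Lⱼ = ∑ᵢ Pᵢⱼ Eᵢ`, `Wⱼ = ∑ᵢ Pᵢⱼ wᵢ`).
[folklore] -/
def form (ι : K[X] →ₐ[K] R) (y : Fin n → R) (q : Fin n → K[X]) : R :=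
  ∑ i, ι (q i) * y i

section FormLinear

variable (ι : K[X] →ₐ[K] R) (y : Fin n → R)

/-- `form` is additive in the coefficient vector. [folklore] -/
theorem form_add (q q' : Fin n → K[X]) : form ι y (q + q') = form ι y q + form ι y q' := by
  simp only [form, Pi.add_apply, map_add, add_mul, Finset.sum_add_distrib]

/-- `form` of the zero vector. [folklore] -/
@[simp] theorem form_zero : form ι y (0 : Fin n → K[X]) = 0 := by
  simp [form]

/-- `form` is homogeneous for polynomial scalars. [folklore] -/
theorem form_smul (g : K[X]) (q : Fin n → K[X]) : form ι y (g • q) = ι g * form ι y q := by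
  simp only [form, Pi.smul_apply, smul_eq_mul, map_mul, Finset.mul_sum, mul_assoc]

/-- `form` is homogeneous for scalars of `K`. [folklore] -/
theorem form_smul_const (c : K) (q : Fin n → K[X]) : form ι y (c • q) = c • form ι y q := by
  simp only [form, Pi.smul_apply, map_smul, smul_mul_assoc, Finset.smul_sum]

/-- `form` of a finite sum of coefficient vectors. [folklore] -/
theorem form_sum {α : Type*} (s : Finset α) (q : α → Fin n → K[X]) :
    form ι y (∑ a ∈ s, q a) = ∑ a ∈ s, form ι y (q a) := by
  classical
  induction s using Finset.induction_on with
  | empty => simp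
  | insert a s ha ih => rw [Finset.sum_insert ha, Finset.sum_insert ha, form_add, ih]

/-- `form` on a standard basis vector `g · eᵢ`. [folklore] -/
theorem form_single (g : K[X]) (i : Fin n) : form ι y (Pi.single i g) = ι g * y i := by
  classical
  simp only [form]
  rw [Finset.sum_eq_single i]
  · simp
  · intro j _ hj
    simp [Pi.single_eq_of_ne hj]
  · simp

/-- The coefficient-vector-to-form map as a `K`-linear map. [folklore] -/
def formLin : (Fin n → K[X]) →ₗ[K] R where
  toFun := form ι y
  map_add' := form_add ι y
  map_smul' := form_smul_const ι y

/-- `formLin` unfolds to `form`. [folklore] -/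
@[simp] theorem formLin_apply (q : Fin n → K[X]) : formLin ι y q = form ι y q := rfl

end FormLinear

/-! ### 2. Baker's recursion `dualD` -/

/-- Baker's recursion on coefficient vectors (Ch. 11, Lemma 2): `(dualD f G q)ᵢ = f qᵢ′ + ∑ₕ Gₕᵢ qₕ`,
the operation on coefficients dual to `L ↦ f L′` on forms in solutions of `f yᵢ′ = ∑ⱼ Gᵢⱼ yⱼ`.
[folklore] -/
def dualD (f : K[X]) (G : Matrix (Fin n) (Fin n) K[X]) (q : Fin n → K[X]) : Fin n → K[X] :=
  fun i => f * derivative (q i) + ∑ h, G h i * q h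

section DualD

variable (f : K[X]) (G : Matrix (Fin n) (Fin n) K[X])

/-- Unfolding `dualD`. [folklore] -/
theorem dualD_apply (q : Fin n → K[X]) (i : Fin n) :
    dualD f G q i = f * derivative (q i) + ∑ h, G h i * q h := rfl

/-- `dualD` is additive. [folklore] -/
theorem dualD_add (q q' : Fin n → K[X]) : dualD f G (q + q') = dualD f G q + dualD f G q' := by
  funext i
  simp only [dualD, Pi.add_apply, derivative_add, mul_add, Finset.sum_add_distrib]
  ring

/-- `dualD` commutes with scalars from `K`. [folklore] -/
theorem dualD_smul_const (c : K) (q : Fin n → K[X]) : dualD f G (c • q) = c • dualD f G q := by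
  funext i
  simp only [dualD, Pi.smul_apply, smul_eq_C_mul, derivative_C_mul]
  rw [mul_add, Finset.mul_sum]
  refine congrArg₂ (· + ·) (by ring) (Finset.sum_congr rfl fun x _ => by ring)

/-- `dualD` of zero. [folklore] -/
@[simp] theorem dualD_zero : dualD f G (0 : Fin n → K[X]) = 0 := by
  funext i; simp [dualD]

/-- Twisted Leibniz rule: `dualD (g q) = f g′ q + g · dualD q`. [folklore] -/
theorem dualD_smul (g : K[X]) (q : Fin n → K[X]) :
    dualD f G (g • q) = (f * derivative g) • q + g • dualD f G q := by
  funext i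
  simp only [dualD, Pi.add_apply, Pi.smul_apply, smul_eq_mul, derivative_mul]
  have hs : ∑ h, G h i * (g * q h) = g * ∑ h, G h i * q h := by
    rw [Finset.mul_sum]
    exact Finset.sum_congr rfl fun h _ => by ring
  rw [hs]
  ring

/-- `dualD` as a `K`-linear endomorphism of `K[X]ⁿ`. [folklore] -/
def dualDLin : (Fin n → K[X]) →ₗ[K] (Fin n → K[X]) where
  toFun := dualD f G
  map_add' := dualD_add f G
  map_smul' := dualD_smul_const f G

/-- `dualDLin` unfolds to `dualD`. [folklore] -/
@[simp] theorem dualDLin_apply (q : Fin n → K[X]) : dualDLin f G q = dualD f G q := rfl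

/-- Iterates of `dualD` are the iterates of the linear map. [folklore] -/
theorem dualD_iterate_eq_pow (j : ℕ) (q : Fin n → K[X]) :
    (dualD f G)^[j] q = (dualDLin f G ^ j) q := by
  induction j generalizing q with
  | zero => simp
  | succ j ih => rw [Function.iterate_succ_apply, ih, pow_succ, Module.End.mul_apply, dualDLin_apply]

/-- Iterates of `dualD` are additive. [folklore] -/
theorem dualD_iterate_add (j : ℕ) (q q' : Fin n → K[X]) :
    (dualD f G)^[j] (q + q') = (dualD f G)^[j] q + (dualD f G)^[j] q' := by
  simp only [dualD_iterate_eq_pow, map_add]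

/-- Iterates of `dualD` of a `K[X]`-combination with CONSTANT-free bookkeeping: finite sums.
[folklore] -/
theorem dualD_iterate_sum {α : Type*} (s : Finset α) (j : ℕ) (q : α → Fin n → K[X]) :
    (dualD f G)^[j] (∑ a ∈ s, q a) = ∑ a ∈ s, (dualD f G)^[j] (q a) := by
  simp only [dualD_iterate_eq_pow, map_sum]

end DualD

/-! ### 3. Solutions and the fundamental identity `ι(f) · d(form q) = form (dualD q)` -/

/-- `y ∈ Rⁿ` solves the system `f yᵢ′ = ∑ⱼ Gᵢⱼ yⱼ`, read in `R` through `ι` and the derivation `d`.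
[folklore] -/
def IsSol (ι : K[X] →ₐ[K] R) (d : Derivation K R R) (f : K[X]) (G : Matrix (Fin n) (Fin n) K[X])
    (y : Fin n → R) : Prop :=
  ∀ i, ι f * d (y i) = ∑ j, ι (G i j) * y j

/-- The derivation `d` of `R` extends `d/dX` along `ι`. [folklore] -/
def DerivCompat (ι : K[X] →ₐ[K] R) (d : Derivation K R R) : Prop :=
  ∀ p : K[X], ι (derivative p) = d (ι p)

section Identity

variable {ι : K[X] →ₐ[K] R} {d : Derivation K R R} {f : K[X]} {G : Matrix (Fin n) (Fin n) K[X]}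
  {y : Fin n → R}

/-- Solutions form a `K`-subspace: sums. [folklore] -/
theorem IsSol.add {y' : Fin n → R} (hy : IsSol ι d f G y) (hy' : IsSol ι d f G y') :
    IsSol ι d f G (y + y') := by
  intro i
  simp only [Pi.add_apply, map_add, mul_add, hy i, hy' i, Finset.sum_add_distrib]

/-- Solutions form a `K`-subspace: scalars. [folklore] -/
theorem IsSol.smul (hy : IsSol ι d f G y) (c : K) : IsSol ι d f G (c • y) := by
  intro i
  simp only [Pi.smul_apply]
  rw [d.map_smul, mul_smul_comm, hy i, Finset.smul_sum]
  exact Finset.sum_congr rfl fun j _ => by rw [mul_smul_comm]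

/-- The zero vector is a solution. [folklore] -/
theorem IsSol.zero : IsSol ι d f G (0 : Fin n → R) := by
  intro i; simp

/-- **Fundamental identity** (Baker Ch. 11, Lemma 2: "`Lⱼ` satisfies `L_{j+1} = f Lⱼ′`"):
for a solution `y`, `ι(f) · d(∑ ι(qᵢ) yᵢ) = ∑ ι((dualD q)ᵢ) yᵢ`. [folklore] -/
theorem form_dualD (hι : DerivCompat ι d) (hy : IsSol ι d f G y) (q : Fin n → K[X]) :
    ι f * d (form ι y q) = form ι y (dualD f G q) := by
  have hι' : ∀ p : K[X], d (ι p) = ι (derivative p) := fun p => (hι p).symm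
  have h1 : ι f * d (form ι y q) =
      ∑ i, ι (f * derivative (q i)) * y i + ∑ i, ι (q i) * (ι f * d (y i)) := by
    simp only [form, map_sum, Derivation.leibniz, smul_eq_mul, Finset.mul_sum, map_mul, hι',
      ← Finset.sum_add_distrib]
    refine Finset.sum_congr rfl fun i _ => ?_
    ring
  have h2 : ∑ i, ι (q i) * (ι f * d (y i)) = ∑ i, ∑ h, ι (G h i * q h) * y i := by
    calc ∑ i, ι (q i) * (ι f * d (y i)) = ∑ i, ∑ j, ι (q i) * (ι (G i j) * y j) := by
          refine Finset.sum_congr rfl fun i _ => ?_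
          rw [hy i, Finset.mul_sum]
      _ = ∑ j, ∑ i, ι (q i) * (ι (G i j) * y j) := Finset.sum_comm
      _ = ∑ i, ∑ h, ι (G h i * q h) * y i := by
          refine Finset.sum_congr rfl fun i _ => Finset.sum_congr rfl fun h _ => ?_
          rw [map_mul]
          ring
  rw [h1, h2, ← Finset.sum_add_distrib]
  simp only [form, dualD, map_add, map_sum, add_mul, Finset.sum_mul]

/-- The operator `x ↦ ι(f) · d x` on `R` (Baker's `f d/dx`). [folklore] -/
def theta (ι : K[X] →ₐ[K] R) (d : Derivation K R R) (f : K[X]) (x : R) : R :=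
  ι f * d x

/-- Iterated fundamental identity: `(ι f · d)^j (form q) = form (dualD^[j] q)`. [folklore] -/
theorem form_dualD_iterate (hι : DerivCompat ι d) (hy : IsSol ι d f G y) (q : Fin n → K[X])
    (j : ℕ) : (theta ι d f)^[j] (form ι y q) = form ι y ((dualD f G)^[j] q) := by
  induction j generalizing q with
  | zero => rfl
  | succ j ih =>
    rw [Function.iterate_succ_apply, Function.iterate_succ_apply, ← ih, ← form_dualD hι hy]
    rfl

end Identity

/-! ### 4. Degree growth -/

section Degrees

variable (f : K[X]) (G : Matrix (Fin n) (Fin n) K[X])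

/-- `m = max(deg f, max deg Gᵢⱼ)`, Baker's "maximum of the degrees of the `f fᵢⱼ` and `f`".
[folklore] -/
def sysDeg : ℕ :=
  max f.natDegree (Finset.univ.sup fun p : Fin n × Fin n => (G p.1 p.2).natDegree)

/-- `deg f ≤ m`. [folklore] -/
theorem natDegree_f_le_sysDeg : f.natDegree ≤ sysDeg f G := le_max_left _ _

/-- `deg Gᵢⱼ ≤ m`. [folklore] -/
theorem natDegree_G_le_sysDeg (i j : Fin n) : (G i j).natDegree ≤ sysDeg f G :=
  le_trans (Finset.le_sup (f := fun p : Fin n × Fin n => (G p.1 p.2).natDegree)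
    (Finset.mem_univ (i, j))) (le_max_right _ _)

/-- One step of the recursion raises degrees by at most `m`. [folklore] -/
theorem natDegree_dualD_le {q : Fin n → K[X]} {N : ℕ} (hq : ∀ i, (q i).natDegree ≤ N) (i : Fin n) :
    (dualD f G q i).natDegree ≤ N + sysDeg f G := by
  rw [dualD_apply]
  refine (natDegree_add_le _ _).trans (max_le ?_ ?_)
  · refine natDegree_mul_le.trans ?_
    have h1 := ((natDegree_derivative_le (q i)).trans (Nat.sub_le _ _)).trans (hq i)
    have h2 := natDegree_f_le_sysDeg f G
    omega
  · refine (natDegree_sum_le _ _).trans ?_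
    rw [Finset.fold_max_le]
    refine ⟨by simp, fun h _ => ?_⟩
    show (G h i * q h).natDegree ≤ N + sysDeg f G
    refine natDegree_mul_le.trans ?_
    have h1 := natDegree_G_le_sysDeg f G h i
    have h2 := hq h
    omega

/-- `j` steps raise degrees by at most `j·m` (Baker: "`P_{ij}` has degree at most `r + mj`").
[folklore] -/
theorem natDegree_dualD_iterate_le {q : Fin n → K[X]} {N : ℕ} (hq : ∀ i, (q i).natDegree ≤ N)
    (j : ℕ) (i : Fin n) : ((dualD f G)^[j] q i).natDegree ≤ N + j * sysDeg f G := by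
  induction j generalizing i with
  | zero => simpa using hq i
  | succ j ih =>
    rw [Function.iterate_succ_apply']
    have := natDegree_dualD_le f G (q := (dualD f G)^[j] q) ih i
    simpa [Nat.succ_mul, add_assoc] using this

end Degrees

/-! ### 5. The power-series instance: orders of vanishing -/

section Orders

variable (K)

/-- The coercion `K[X] → K⟦X⟧` as a `K`-algebra map. [folklore] -/
def coeAlgHom : K[X] →ₐ[K] PowerSeries K :=
  Polynomial.coeToPowerSeries.algHom K

/-- `coeAlgHom` is the coercion. [folklore] -/
@[simp] theorem coeAlgHom_apply (p : K[X]) : coeAlgHom K p = (p : PowerSeries K) := by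
  ext m
  simp only [coeAlgHom, Polynomial.coeToPowerSeries.algHom_apply, PowerSeries.coeff_map,
    Algebra.algebraMap_self, RingHom.id_apply]

/-- The coercion is compatible with the derivations `d/dX`. [folklore] -/
theorem derivCompat_coe : DerivCompat (coeAlgHom K) (PowerSeries.derivative K) := by
  intro p
  simp [PowerSeries.derivative_coe]

variable {K}

/-- `f · F′` vanishes to order `≥ N` if `F` vanishes to order `≥ N + 1`. [folklore] -/
theorem le_order_theta {F : PowerSeries K} {N : ℕ} (f : K[X])
    (h : ((N + 1 : ℕ) : ℕ∞) ≤ F.order) :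
    (N : ℕ∞) ≤ (theta (coeAlgHom K) (PowerSeries.derivative K) f F).order := by
  unfold theta
  refine le_trans ?_ (PowerSeries.le_order_mul _ _)
  refine le_add_left (PowerSeries.nat_le_order _ _ fun i hi => ?_)
  rw [PowerSeries.coeff_derivative, PowerSeries.coeff_of_lt_order, zero_mul]
  exact lt_of_lt_of_le (by exact_mod_cast Nat.succ_lt_succ hi) h

/-- Iterating: `(f d/dX)^j F` vanishes to order `≥ N` if `F` vanishes to order `≥ N + j`.
[folklore] -/
theorem le_order_theta_iterate {N : ℕ} (f : K[X]) (j : ℕ) :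
    ∀ {F : PowerSeries K}, ((N + j : ℕ) : ℕ∞) ≤ F.order →
      (N : ℕ∞) ≤ ((theta (coeAlgHom K) (PowerSeries.derivative K) f)^[j] F).order := by
  induction j generalizing N with
  | zero => intro F h; simpa using h
  | succ j ih =>
    intro F h
    rw [Function.iterate_succ_apply']
    refine le_order_theta f (ih ?_)
    have heq : N + 1 + j = N + (j + 1) := by omega
    rw [heq]
    exact h

/-- **Orders of the derived forms** (Baker p. 110: "each element of `L` has a zero at `x = 0`
with order at least `M − n`"): if `∑ Pᵢ Eᵢ` vanishes to order `≥ N + j` then the `j`-th derived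
form `∑ (dualD^[j] P)ᵢ Eᵢ` vanishes to order `≥ N`. [folklore] -/
theorem le_order_form_dualD_iterate {f : K[X]} {G : Matrix (Fin n) (Fin n) K[X]}
    {E : Fin n → PowerSeries K}
    (hE : IsSol (coeAlgHom K) (PowerSeries.derivative K) f G E) (P : Fin n → K[X]) {N : ℕ} (j : ℕ)
    (h : ((N + j : ℕ) : ℕ∞) ≤ (form (coeAlgHom K) E P).order) :
    (N : ℕ∞) ≤ (form (coeAlgHom K) E ((dualD f G)^[j] P)).order := by
  rw [← form_dualD_iterate (derivCompat_coe K) hE P j]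
  exact le_order_theta_iterate f j h

end Orders

/-! ### 6. The Taylor-shift instance (solutions expanded at a regular point `z₀`) -/

section Shift

variable (K)

/-- `p ↦ p(X + z₀)` followed by the coercion into `K⟦X⟧`: the expansion of polynomials at the
point `z₀`. [folklore] -/
def shiftAlgHom (z₀ : K) : K[X] →ₐ[K] PowerSeries K :=
  (coeAlgHom K).comp (taylorAlgHom z₀)

/-- `shiftAlgHom z₀ p = ↑(taylor z₀ p)`. [folklore] -/
theorem shiftAlgHom_apply (z₀ : K) (p : K[X]) :
    shiftAlgHom K z₀ p = ((taylor z₀ p : K[X]) : PowerSeries K) := by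
  simp [shiftAlgHom, taylorAlgHom]

/-- The Taylor shift is compatible with `d/dX` (chain rule with `(X + z₀)′ = 1`). [folklore] -/
theorem derivCompat_shift (z₀ : K) : DerivCompat (shiftAlgHom K z₀) (PowerSeries.derivative K) := by
  intro p
  rw [shiftAlgHom_apply, shiftAlgHom_apply, PowerSeries.derivative_coe, taylor_apply, taylor_apply,
    derivative_comp]
  simp

/-- The Taylor shift is injective. [folklore] -/
theorem shiftAlgHom_injective (z₀ : K) : Function.Injective (shiftAlgHom K z₀) := by
  intro p q h
  rw [shiftAlgHom_apply, shiftAlgHom_apply, Polynomial.coe_inj] at h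
  exact taylor_injective z₀ h

/-- Constant coefficient of the shifted polynomial is the value at `z₀`. [folklore] -/
theorem constantCoeff_shiftAlgHom (z₀ : K) (p : K[X]) :
    PowerSeries.constantCoeff (shiftAlgHom K z₀ p) = p.eval z₀ := by
  rw [shiftAlgHom_apply, ← PowerSeries.coeff_zero_eq_constantCoeff_apply, Polynomial.coeff_coe,
    taylor_coeff_zero]

/-- If `f(z₀) ≠ 0` then the shifted `f` is a unit of `K⟦X⟧` (a regular point of the system).
[folklore] -/
theorem isUnit_shiftAlgHom {z₀ : K} {f : K[X]} (hf : f.eval z₀ ≠ 0) : IsUnit (shiftAlgHom K z₀ f) := by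
  rw [PowerSeries.isUnit_iff_constantCoeff, constantCoeff_shiftAlgHom]
  exact isUnit_iff_ne_zero.mpr hf

end Shift

/-! ### 7. The determinant `Δ` -/

section Delta

variable (f : K[X]) (G : Matrix (Fin n) (Fin n) K[X])

/-- The matrix `(P_{ij})` of Baker's Lemma 2: row `i`, column `j` holds the `i`-th coefficient of
the `j`-th derived vector `dualD^[j] P` (`j = 0, …, n−1`; Baker indexes `j = 1, …, n`).
[folklore] -/
def dMat (P : Fin n → K[X]) : Matrix (Fin n) (Fin n) K[X] :=
  Matrix.of fun i j => ((dualD f G)^[(j : ℕ)] P) i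

/-- Entries of `dMat`. [folklore] -/
@[simp] theorem dMat_apply (P : Fin n → K[X]) (i j : Fin n) :
    dMat f G P i j = ((dualD f G)^[(j : ℕ)] P) i := rfl

/-- Baker's determinant `Δ(x) = det (P_{ij})`. [folklore] -/
def Δ (P : Fin n → K[X]) : K[X] :=
  (dMat f G P).det

/-- Degree of a determinant with column-wise degree bounds. [folklore] -/
theorem natDegree_det_le_of_column {m : ℕ} (M : Matrix (Fin m) (Fin m) K[X]) (b : Fin m → ℕ)
    (h : ∀ i j, (M i j).natDegree ≤ b j) : M.det.natDegree ≤ ∑ j, b j := by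
  rw [Matrix.det_apply]
  refine (natDegree_sum_le _ _).trans ?_
  rw [Finset.fold_max_le]
  refine ⟨by simp, fun σ _ => ?_⟩
  simp only [Function.comp_apply]
  refine (natDegree_smul_le _ _).trans ((natDegree_prod_le _ _).trans ?_)
  calc ∑ i, (M (σ i) i).natDegree ≤ ∑ i, b i := Finset.sum_le_sum fun i _ => h (σ i) i
    _ = ∑ j, b j := rfl

/-- **Degree of `Δ`** (Baker p. 111: "a polynomial with degree at most `kr + c`"): if `deg Pᵢ ≤ r`
then `deg Δ ≤ n r + n² m`. [folklore] -/
theorem natDegree_Δ_le {P : Fin n → K[X]} {r : ℕ} (hP : ∀ i, (P i).natDegree ≤ r) :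
    (Δ f G P).natDegree ≤ n * r + n * n * sysDeg f G := by
  unfold Δ
  refine (natDegree_det_le_of_column (dMat f G P) (fun j => r + (j : ℕ) * sysDeg f G)
    fun i j => ?_).trans ?_
  · rw [dMat_apply]
    exact natDegree_dualD_iterate_le f G hP j i
  · calc ∑ j : Fin n, (r + (j : ℕ) * sysDeg f G)
        ≤ ∑ _j : Fin n, (r + n * sysDeg f G) := Finset.sum_le_sum fun j _ =>
            Nat.add_le_add_left (Nat.mul_le_mul_right _ j.isLt.le) _
      _ = n * r + n * n * sysDeg f G := by
            rw [Finset.sum_const, Finset.card_univ, Fintype.card_fin, smul_eq_mul]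
            ring

end Delta

end SiegelShidlovskii

end Literature.Barriers.Schanuel

end
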